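import Literature.Computability.Complexity.LundYannakakisGadget
import HarnessLib

/-!
# The Lund–Yannakakis reduction, III: the soundness bound; Thm. 22.31 from the implementation fact

Topic `Computability/Complexity`, namespace `Literature.Computability.Complexity` (dot-lemmas
under `LabelCoverInstance`). Continues `LundYannakakis.lean` (construction, completeness) and
`LundYannakakisGadget.lean` (complementary pair `exists_good_pair`, averaging
`exists_assignment`). Proves the NO case of Arora–Barak 2009, Thm. 22.31 in the sharpened
counting form `n² < ε |T|²` for every cover `T` (the printed Claim gives `|T| ≥ n/(4√ε)` via
Markov; here convexity), and derives the named fact `AroraBarak2009_thm2231` from the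
implementation fact `lyMap_mem_FP`.

* `length_pow_three_le` — tangent-line Jensen for `s ↦ 1/s²`:
  `m³ ≤ (Σ_r 1/s_r²) (Σ_r s_r)²`.
* `sq_numVars_lt_card_sq` — `ε m > Σ_r 1/(a_i a_j) ≥ Σ_r 4/(a_i + a_j)² ≥ 4m³/(d|T|)²`
  with `Σ_r (a_{i_r} + a_{j_r}) = d |T|` and `n d = 2m`, i.e. `n² < ε |T|²`.
* `lyReduce_mem_noSet` — for `0 < c`, `16 c² ε ≤ 1` every cover has `≥ c n = c K` sets.
* `AroraBarak2009_thm2231_of_FP` — on the promise `lyMap W = lyReduce` (`lyMap_eq_lyReduce`: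
  regular well-formed instances have `n ≤ 2m`), so the `FP` function of `lyMap_mem_FP` maps
  YES codes to YES codes (`lyReduce_mem_yesSet`) and NO codes to NO codes.

## References

* S. Arora, B. Barak, *Computational Complexity: A Modern Approach*, CUP 2009, §22.8:
  Thm. 22.31 and its proof ("The analysis", Claim), pp. 486–488.
* C. Lund, M. Yannakakis, *On the hardness of approximating minimization problems*, J. ACM 41
  (1994) 960–981, §3.
-/

namespace Literature.Computability.Complexity

open _root_.Computability Finset

/-- **Tangent-line Jensen for `s ↦ 1/s²`**: for positive reals `s_1, …, s_m` with sum `S`,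
`m³ ≤ (Σ_r 1/s_r²) · S²` (pointwise `1/s² ≥ m²(3S - 2ms)/S³`, i.e.
`(S - ms)²(S + 2ms) ≥ 0`, summed). [folklore] -/
theorem length_pow_three_le {α : Type*} (L : List α) (F : α → ℝ)
    (hF : ∀ x ∈ L, 0 < F x) :
    (L.length : ℝ) ^ 3 ≤ (L.map fun x => ((F x) ^ 2)⁻¹).sum * (L.map F).sum ^ 2 := by
  rcases eq_or_ne L [] with hL | hL
  · subst hL; simp
  set S := (L.map F).sum with hS
  set m : ℕ := L.length with hm
  have hSpos : 0 < S := by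
    refine List.sum_pos _ (fun y hy => ?_) (fun h0 => hL (List.map_eq_nil_iff.1 h0))
    obtain ⟨x, hx, rfl⟩ := List.mem_map.1 hy
    exact hF x hx
  -- pointwise tangent bound `(S - m s)² (S + 2 m s) ≥ 0`
  have hpt : ∀ x ∈ L,
      3 * (m : ℝ) ^ 2 / S ^ 2 + -(2 * (m : ℝ) ^ 3 / S ^ 3) * F x ≤ ((F x) ^ 2)⁻¹ := by
    intro x hx
    have hs := hF x hx
    have key : 0 ≤ (S - m * F x) ^ 2 * (S + 2 * m * F x) :=
      mul_nonneg (sq_nonneg _) (by positivity)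
    have hS3 : (0 : ℝ) < S ^ 3 := by positivity
    have hx2 : (0 : ℝ) < F x ^ 2 := by positivity
    rw [show 3 * (m : ℝ) ^ 2 / S ^ 2 + -(2 * (m : ℝ) ^ 3 / S ^ 3) * F x =
        (3 * (m : ℝ) ^ 2 * S - 2 * (m : ℝ) ^ 3 * F x) / S ^ 3 by field_simp; ring,
      div_le_iff₀ hS3, ← one_div, one_div_mul_eq_div, le_div_iff₀ hx2]
    nlinarith [key]
  have hsum : (L.map fun x => 3 * (m : ℝ) ^ 2 / S ^ 2 + -(2 * (m : ℝ) ^ 3 / S ^ 3) * F x).sum =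
      (m : ℝ) ^ 3 / S ^ 2 := by
    rw [List.sum_map_add, List.sum_map_mul_left, List.map_const', List.sum_replicate, ← hS,
      nsmul_eq_mul, ← hm]
    field_simp
    ring
  calc (m : ℝ) ^ 3 = (m : ℝ) ^ 3 / S ^ 2 * S ^ 2 := by field_simp
    _ ≤ (L.map fun x => ((F x) ^ 2)⁻¹).sum * S ^ 2 := by
      rw [← hsum]
      exact mul_le_mul_of_nonneg_right (List.sum_le_sum hpt) (by positivity)

namespace LabelCoverInstance

/-! ### The soundness bound -/

/-- **Soundness of the Lund–Yannakakis reduction (NO case, hypercube gadget), counting form.**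
If `φ` is well formed and regular and every assignment satisfies fewer than `ε m` constraints,
then every cover `T` of `lyReduce φ` has `n² < ε |T|²`, i.e. more than `n / √ε` sets (the
printed Claim: at least `n / (4√ε)`). Chain:
`ε m > Σ_r 1/(a_i a_j) ≥ Σ_r 4/(a_i + a_j)² ≥ 4m³/(d|T|)²` with `n d = 2m`.
[cite: AroraBarak2009, Thm. 22.31 (§22.8, proof, Claim)] -/
theorem sq_numVars_lt_card_sq {φ : LabelCoverInstance} (hwf : φ.WellFormed)
    (hreg : φ.IsRegular) {ε : ℝ}
    (hno : ∀ a : ℕ → ℕ, (φ.satCount a : ℝ) < ε * φ.numConstraints)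
    {T : Finset ℕ} (hT : φ.lyReduce.IsCover T) :
    (φ.numVars : ℝ) ^ 2 < ε * (T.card : ℝ) ^ 2 := by
  classical
  obtain ⟨d, hd, hdeg, hnd⟩ := hwf.exists_degree hreg
  set W := φ.alphabetSize with hW
  set a : ℕ → ℝ := fun i => (((range W).filter fun u => W * i + u ∈ T).card : ℝ) with ha
  set m := φ.numConstraints with hm
  have hmpos : (0 : ℝ) < m := by exact_mod_cast hwf.1
  -- `S = Σ_r (a_i + a_j) = d |T|`
  have hS : (φ.constraints.map fun C => a C.fst + a C.snd).sum = d * T.card := by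
    rw [hwf.sum_map_add_eq_sum_degree_smul a, φ.card_eq_sum_card_assoc fun p hp => ?_]
    · rw [Nat.cast_sum, Finset.mul_sum]
      refine Finset.sum_congr rfl fun i hi => ?_
      rw [hdeg i (Finset.mem_range.1 hi), nsmul_eq_mul]
    · have := hT.1 p hp
      rwa [length_lyReduce_sets] at this
  -- positivity of the summands
  have hapos : ∀ C ∈ φ.constraints, 0 < a C.fst ∧ 0 < a C.snd := by
    intro C hC
    have hwC := hwf.2 C hC
    exact ⟨Nat.cast_pos.2 (assoc_nonempty hwf hreg hT hwC.1).card_pos,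
      Nat.cast_pos.2 (assoc_nonempty hwf hreg hT hwC.2.1).card_pos⟩
  -- averaging
  obtain ⟨asg, hasg⟩ := exists_assignment hwf hreg hT
  have h1 : (φ.constraints.map fun C => (a C.fst * a C.snd)⁻¹).sum < ε * m :=
    hasg.trans_lt (hno asg)
  -- AM–GM termwise: `1/(xy) ≥ 4/(x+y)²`
  have h2 : (φ.constraints.map fun C => 4 * ((a C.fst + a C.snd) ^ 2)⁻¹).sum ≤
      (φ.constraints.map fun C => (a C.fst * a C.snd)⁻¹).sum := by
    refine List.sum_le_sum fun C hC => ?_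
    obtain ⟨hx, hy⟩ := hapos C hC
    rw [← div_eq_mul_inv, div_le_iff₀ (by positivity), ← div_eq_inv_mul,
      le_div_iff₀ (by positivity)]
    nlinarith [sq_nonneg (a C.fst - a C.snd)]
  -- tangent-line Jensen: `m³ ≤ (Σ 1/s²) S²`
  have h3 := length_pow_three_le φ.constraints (fun C => a C.fst + a C.snd)
    fun C hC => add_pos (hapos C hC).1 (hapos C hC).2
  rw [hS] at h3
  change (m : ℝ) ^ 3 ≤ _ at h3
  rw [List.sum_map_mul_left] at h2
  -- combine: `4 m³ ≤ 4 (Σ 1/s²) (d|T|)² < ε m (d|T|)²`, and `(n d)² = 4 m²`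
  have hnd' : (φ.numVars : ℝ) * d = 2 * m := by rw [hm]; exact_mod_cast hnd
  have hdpos : (0 : ℝ) < d := by exact_mod_cast hd
  have hTpos : (0 : ℝ) < d * T.card := by
    -- `S > 0` since `m ≥ 1` and the summands are positive
    rw [← hS]
    refine List.sum_pos _ (fun x hx => ?_) (fun h0 => ?_)
    · obtain ⟨C, hC, rfl⟩ := List.mem_map.1 hx
      exact add_pos (hapos C hC).1 (hapos C hC).2
    · rw [List.map_eq_nil_iff] at h0
      have h1 := hwf.1
      rw [numConstraints, h0] at h1
      exact absurd h1 (lt_irrefl 0)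
  have h4 : (m : ℝ) ^ 3 * 4 < ε * m * ((d : ℝ) * T.card) ^ 2 := by
    calc (m : ℝ) ^ 3 * 4 ≤ (φ.constraints.map fun C => ((a C.fst + a C.snd) ^ 2)⁻¹).sum *
          ((d : ℝ) * T.card) ^ 2 * 4 := by nlinarith [h3]
      _ = 4 * (φ.constraints.map fun C => ((a C.fst + a C.snd) ^ 2)⁻¹).sum *
          ((d : ℝ) * T.card) ^ 2 := by ring
      _ < ε * m * ((d : ℝ) * T.card) ^ 2 :=
          mul_lt_mul_of_pos_right (h2.trans_lt h1) (by positivity)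
  -- divide by `m d² > 0`
  have h5 : (2 * (m : ℝ)) ^ 2 < ε * ((d : ℝ) * T.card) ^ 2 := by nlinarith [h4, hmpos]
  rw [← hnd'] at h5
  have h6 : (d : ℝ) ^ 2 * (φ.numVars : ℝ) ^ 2 < (d : ℝ) ^ 2 * (ε * (T.card : ℝ) ^ 2) := by
    nlinarith [h5]
  exact lt_of_mul_lt_mul_left h6 (by positivity)

/-- **NO case of Thm. 22.31 at the level of instances.** For `φ` well formed and regular with
`val(φ) < ε` and a factor `c > 0` with `16 c² ε ≤ 1` (i.e. `c ≤ 1/(4√ε) = T` as printed),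
every set cover of `lyReduce φ` has at least `c · K = c n` sets:
`lyReduce φ ∈ GapSetCover.noSet c`.
[cite: AroraBarak2009, Thm. 22.31 (§22.8, "every set cover must have at least `nT` sets")] -/
theorem lyReduce_mem_noSet {φ : LabelCoverInstance} (hwf : φ.WellFormed) (hreg : φ.IsRegular)
    {ε : ℝ} {c : ℚ} (hc : 0 < c) (hcε : (c : ℝ) ^ 2 * ε * 16 ≤ 1)
    (hno : ∀ a : ℕ → ℕ, (φ.satCount a : ℝ) < ε * φ.numConstraints) :
    φ.lyReduce ∈ GapSetCover.noSet c := by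
  intro T hT
  have h := sq_numVars_lt_card_sq hwf hreg hno hT
  rw [lyReduce_K]
  have hc' : (0 : ℝ) < c := by exact_mod_cast hc
  have hreal : (c : ℝ) * φ.numVars ≤ T.card := by
    by_contra hlt
    push Not at hlt
    have hT0 : (0 : ℝ) ≤ T.card := Nat.cast_nonneg _
    -- `|T|² < c² n² < c² ε |T|² ≤ |T|²/16`
    have h1 : (T.card : ℝ) ^ 2 < ((c : ℝ) * φ.numVars) ^ 2 :=
      pow_lt_pow_left₀ hlt hT0 two_ne_zero
    nlinarith [h1, h, mul_pos hc' hc', sq_nonneg (T.card : ℝ)]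
  have hq : ((c * φ.numVars : ℚ) : ℝ) ≤ ((T.card : ℚ) : ℝ) := by push_cast; exact hreal
  exact_mod_cast (Rat.cast_le.1 hq)

end LabelCoverInstance

/-! ### Thm. 22.31 from the implementation fact -/

/-- **Arora–Barak 2009, Thm. 22.31, from the implementation fact.** If the patched
Lund–Yannakakis map `lyMap W` is computed on codes by an `FP` function (`lyMap_mem_FP`), then
for `0 < ε`, `0 < c`, `16 c² ε ≤ 1` the gap label cover problem `gapLabelCover W ε`
Karp-reduces to `gapSetCover c`: on the promise `lyMap W = lyReduce` (`lyMap_eq_lyReduce`),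
YES instances go to exact covers of size `K = n ≥ 1` (`lyReduce_mem_yesSet`) and NO instances
to instances all of whose covers have `≥ c n` sets (`lyReduce_mem_noSet`).
[cite: AroraBarak2009, Thm. 22.31 (§22.8, p. 486)] -/
theorem AroraBarak2009_thm2231_of_FP (hFP : lyMap_mem_FP) : AroraBarak2009_thm2231 := by
  intro W ε c _hε hc hcε
  obtain ⟨f, hf, hfφ⟩ := hFP W
  refine ⟨f, hf, ?_, ?_⟩
  · rintro x ⟨φ, ⟨hwf, hW, hreg, hsat⟩, rfl⟩
    refine ⟨LabelCoverInstance.lyMap W φ, ?_, (hfφ φ).symm⟩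
    rw [LabelCoverInstance.lyMap_eq_lyReduce hW hwf hreg]
    exact LabelCoverInstance.lyReduce_mem_yesSet hwf hsat
  · rintro x ⟨φ, ⟨hwf, hW, hreg, hno⟩, rfl⟩
    refine ⟨LabelCoverInstance.lyMap W φ, ?_, (hfφ φ).symm⟩
    rw [LabelCoverInstance.lyMap_eq_lyReduce hW hwf hreg]
    exact LabelCoverInstance.lyReduce_mem_noSet hwf hreg hc hcε hno

end Literature.Computability.Complexity
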